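import Mathlib
import HarnessLib
import Literature.MathematicalPhysics.QuantumManyBody.PeriodicBoseGasFourier
import Literature.MathematicalPhysics.QuantumManyBody.OneBodyCurrentGain
import Literature.MathematicalPhysics.QuantumManyBody.CouplingPathSliceFloor
import Literature.MathematicalPhysics.QuantumManyBody.DiluteBoseGasUpperBoundLocalization
import Literature.MathematicalPhysics.QuantumManyBody.PeriodicFeynmanKacCompact
import Summits.AtomisticToContinuum.BoseEinsteinCondensation.Theorems.DensityResponse.Negative.PeriodisedWell

/-!
# Crux `InfraredMinimumUncertainty` (stmt-AtomisticToContinuum-11784), line `fisher-gaussian-density-mode`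
# (lead reshape r1) — hypothesis bookkeeping for the core stub `stub_phaseSteinDomination`

Negative-side (refuter, drefute gen 3) lemma: in the registered core stub `stub_phaseSteinDomination`
the MINIMALITY hypothesis `periodicEnergy v Ψ = periodicGroundStateEnergy v N L` is **implied** by the
stub's own weak Euler–Lagrange hypothesis (already at the single test function `η = Ψ`) together with
finiteness `periodicEnergy v Ψ ≠ ⊤`.  Indeed the weak identity at `η = Ψ` reads
`∫ (|∇Ψ|² + W|Ψ|²) = E₀ · ∫|Ψ|² = E₀` in `ℝ`, and for the smooth class the interaction is bounded, so the
left side is `(periodicEnergy v Ψ).toReal` (`periodicForm_eq_ofReal`); `E₀ ≤ E(Ψ) < ∞` makes `toReal`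
faithful.  Conversely minimality implies the weak identity for every admissible `η` (the landed stub
`stub_weakEulerLagrange`, `Theorems/BECConjugateDominationInfraredMinimumUncertaintyWeakEulerLagrange.lean`,
p78669 — not imported here only because its olean is not yet on the farm; the `iff` is the two theorems
side by side), so **`{minimality, finiteness}` and `{weak E–L (all η), finiteness}` are EQUIVALENT
hypothesis sets**: the r1 cut of FD into
`{SteinIdentity, WeakEulerLagrange, CoherenceRegular, PhaseSteinDomination}` exposes lemmas but does not
weaken the core — "drop minimality, keep weak E–L" is NOT an available weakening of the crux frame, and
Disproof.lean §H (`fdV_false_without_minimality`) applies verbatim to any such restatement.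

No statement of the route is asserted; pure hypothesis algebra over tree declarations.
-/

noncomputable section

open MeasureTheory Filter Set
open scoped ENNReal NNReal Topology ComplexConjugate BigOperators

namespace Summit.AtomisticToContinuum.BoseEinsteinCondensation.Theorems.InfraredMinimumUncertainty.Negative

open Literature.MathematicalPhysics.QuantumManyBody.BoseGas
open Summit.AtomisticToContinuum.BoseEinsteinCondensation.Theorems.DensityResponse.Negative
  (sqWell periodizedPotential_sqWell_le ω₃)

variable {N : ℕ} {L : ℝ}


/-! ### Bridge lemmas (local copies, verbatim from the landed
`Theorems/BECConjugateDominationInfraredMinimumUncertaintyWeakEulerLagrange.lean`, namespace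
`…Theorems.ImuWeakEulerLagrange`; kept `private` here so that this file does not depend on that module) -/

/-- A finite-range profile, finite and continuous as `x ↦ v(|x|)`, is bounded and vanishes beyond a range `R ≥ 0` (copy of `ImuWeakEulerLagrange.exists_bound_of_finiteRange`). [folklore] -/
private theorem exists_bound_of_finiteRange' {v : ℝ → ℝ≥0∞} (hv : IsRepulsiveFiniteRange v)
    (htop : ∀ r, v r ≠ ⊤) (hcont : Continuous fun x : Space => (v ‖x‖).toReal) :
    ∃ C R : ℝ, 0 ≤ C ∧ 0 ≤ R ∧ (∀ x : Space, v ‖x‖ ≤ ENNReal.ofReal C) ∧ ∀ r, R < r → v r = 0 := by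
  obtain ⟨R₀, hR₀⟩ := hv.2
  have hR : ∀ r, max R₀ 0 < r → v r = 0 := fun r hr => hR₀ r ((le_max_left _ _).trans_lt hr)
  have hsupp : HasCompactSupport fun x : Space => (v ‖x‖).toReal := by
    refine HasCompactSupport.intro (isCompact_closedBall (0 : Space) (max R₀ 0)) fun x hx => ?_
    rw [Metric.mem_closedBall, dist_zero_right, not_le] at hx
    simp [hR _ hx]
  obtain ⟨C, hC⟩ := hcont.bounded_above_of_compact_support hsupp
  refine ⟨max C 0, max R₀ 0, le_max_right _ _, le_max_right _ _, fun x => ?_, hR⟩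
  rw [← ENNReal.ofReal_toReal (htop ‖x‖)]
  refine ENNReal.ofReal_le_ofReal ?_
  have h1 := hC x
  rw [Real.norm_eq_abs] at h1
  exact ((le_abs_self _).trans h1).trans (le_max_left _ _)

/-- `v^per ≤ C |B₁| (R/L+1)³` for a profile bounded by `C` of range `R` (copy of `ImuWeakEulerLagrange.periodizedPotential_le_of_bound`). [folklore] -/
private theorem periodizedPotential_le_of_bound' {v : ℝ → ℝ≥0∞} {C R : ℝ} (hC : 0 ≤ C) (hR : 0 ≤ R)
    (hL : 0 < L) (hvC : ∀ x : Space, v ‖x‖ ≤ ENNReal.ofReal C) (hvR : ∀ r, R < r → v r = 0)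
    (x : Space) : periodizedPotential v L x ≤ ENNReal.ofReal (C * ((R / L + 1) ^ 3 * ω₃)) := by
  refine le_trans ?_ (periodizedPotential_sqWell_le hC hR hL x)
  unfold periodizedPotential
  refine ENNReal.tsum_le_tsum fun m => ?_
  by_cases h : ‖x - latticeVec L m‖ ≤ R
  · rw [show sqWell C R ‖x - latticeVec L m‖ = ENNReal.ofReal C from
      Set.indicator_of_mem (Set.mem_Iic.2 h) _]
    exact hvC _
  · rw [hvR _ (lt_of_not_ge h)]
    exact zero_le

/-- The periodic interaction of the smooth class is bounded by a finite constant (copy of `ImuWeakEulerLagrange.exists_periodicInteraction_le`). [folklore] -/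
private theorem exists_periodicInteraction_le' {v : ℝ → ℝ≥0∞} (hv : IsRepulsiveFiniteRange v)
    (htop : ∀ r, v r ≠ ⊤) (hcont : Continuous fun x : Space => (v ‖x‖).toReal) (hL : 0 < L)
    (N : ℕ) : ∃ Cw : ℝ≥0∞, Cw ≠ ⊤ ∧ ∀ X : Config N, periodicInteraction v L X ≤ Cw := by
  obtain ⟨C, R, hC, hR, hvC, hvR⟩ := exists_bound_of_finiteRange' hv htop hcont
  exact ⟨_, ENNReal.mul_ne_top (ENNReal.natCast_ne_top _) ENNReal.ofReal_ne_top,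
    fun X => periodicInteraction_le_of_bound (periodizedPotential_le_of_bound' hC hR hL hvC hvR) X⟩

/-- A bounded interaction times a continuous function is integrable on the cell (copy of `ImuWeakEulerLagrange.integrableOn_toReal_interaction_mul`). [folklore] -/
private theorem integrableOn_toReal_interaction_mul' {v : ℝ → ℝ≥0∞} {Cw : ℝ≥0∞}
    (hvm : Measurable v) (hCw : Cw ≠ ⊤)
    (hW : ∀ X : Config N, periodicInteraction v L X ≤ Cw) {g : Config N → ℝ} (hg : Continuous g) :
    IntegrableOn (fun X => (periodicInteraction v L X).toReal * g X) (cellN N L) := by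
  refine Integrable.bdd_mul (c := Cw.toReal) (integrableOn_cellN hg L)
    (measurable_periodicInteraction hvm L).ennreal_toReal.aestronglyMeasurable
    (ae_of_all _ fun X => ?_)
  rw [Real.norm_of_nonneg ENNReal.toReal_nonneg]
  exact ENNReal.toReal_mono hCw (hW X)

/-- `∫⁻ ‖Φ‖₊² = ofReal ∫ ‖Φ‖²` for continuous `Φ` on the cell (copy of `ImuWeakEulerLagrange.lintegral_nnnorm_sq_eq_ofReal`). [folklore] -/
private theorem lintegral_nnnorm_sq_eq_ofReal' {Φ : Config N → ℂ} (hΦ : Continuous Φ) (L : ℝ) :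
    ∫⁻ X in cellN N L, (‖Φ X‖₊ : ℝ≥0∞) ^ 2 = ENNReal.ofReal (∫ X in cellN N L, ‖Φ X‖ ^ 2) := by
  rw [ofReal_integral_eq_lintegral_ofReal (integrableOn_cellN (hΦ.norm.fun_pow 2) L)
    (ae_of_all _ fun X => sq_nonneg _)]
  exact lintegral_congr fun X => coe_nnnorm_sq_eq_ofReal _

/-- The `ℝ≥0∞` form of a `C¹` function under a bounded interaction is the `ofReal` of the real Bochner form (copy of `ImuWeakEulerLagrange.periodicForm_eq_ofReal`). [cite: Fournais2020, (1.1)] -/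
private theorem periodicForm_eq_ofReal' {v : ℝ → ℝ≥0∞} {Cw : ℝ≥0∞} (hvm : Measurable v)
    (hCw : Cw ≠ ⊤) (hW : ∀ X : Config N, periodicInteraction v L X ≤ Cw) {Φ : Config N → ℂ}
    (hΦ : ContDiff ℝ 1 Φ) :
    ∫⁻ X in cellN N L, (kineticDensity Φ X + periodicInteraction v L X * (‖Φ X‖₊ : ℝ≥0∞) ^ 2) =
      ENNReal.ofReal (∫ X in cellN N L,
        (kineticDensityReal Φ X + (periodicInteraction v L X).toReal * ‖Φ X‖ ^ 2)) := by
  have hint : IntegrableOn (fun X => kineticDensityReal Φ X +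
      (periodicInteraction v L X).toReal * ‖Φ X‖ ^ 2) (cellN N L) :=
    (integrableOn_cellN (continuous_kineticDensityReal hΦ) L).add
      (integrableOn_toReal_interaction_mul' hvm hCw hW (hΦ.continuous.norm.pow 2))
  rw [ofReal_integral_eq_lintegral_ofReal hint (ae_of_all _ fun X =>
    add_nonneg (kineticDensityReal_nonneg Φ X) (mul_nonneg ENNReal.toReal_nonneg (sq_nonneg _)))]
  refine lintegral_congr fun X => ?_
  rw [ENNReal.ofReal_add (kineticDensityReal_nonneg Φ X)
      (mul_nonneg ENNReal.toReal_nonneg (sq_nonneg _)),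
    kineticDensity_eq_ofReal, ENNReal.ofReal_mul ENNReal.toReal_nonneg,
    ENNReal.ofReal_toReal (ne_top_of_le_ne_top hCw (hW X)), coe_nnnorm_sq_eq_ofReal]

/-- At `η = Φ` the kinetic pairing of the weak Euler–Lagrange identity is the kinetic density:
`∑ᵢ∑ₖ Re(conj(∂_{ik}Φ) ∂_{ik}Φ) = ∑ᵢ∑ₖ |∂_{ik}Φ|² = kineticDensityReal Φ` (the stub sums the real parts). [folklore] -/
theorem re_sum_conj_fderiv_mul_self (Φ : Config N → ℂ) (X : Config N) :
    (∑ i : Fin N, ∑ k : Fin 3,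
        (conj (fderiv ℝ Φ X (Pi.single i (EuclideanSpace.single k (1 : ℝ)))) *
          fderiv ℝ Φ X (Pi.single i (EuclideanSpace.single k (1 : ℝ)))).re) =
      kineticDensityReal Φ X := by
  unfold kineticDensityReal
  refine Finset.sum_congr rfl fun i _ => ?_
  refine Finset.sum_congr rfl fun k _ => ?_
  rw [Complex.conj_mul', ← Complex.ofReal_pow, Complex.ofReal_re]

/-- The mass of a periodic trial state in real form: `∫_{cell^N} Re(conj Ψ · Ψ) = 1`. [folklore] -/
theorem integral_re_conj_mul_self_eq_one (Ψ : PeriodicTrialState N L) :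
    ∫ X in cellN N L, (conj (Ψ.ψ X) * Ψ.ψ X).re = 1 := by
  simp_rw [Complex.conj_mul', ← Complex.ofReal_pow, Complex.ofReal_re]
  have h1 := lintegral_nnnorm_sq_eq_ofReal' Ψ.contDiff.continuous L
  rw [Ψ.norm_eq] at h1
  rw [← ENNReal.toReal_ofReal (integral_nonneg fun X => sq_nonneg ‖Ψ.ψ X‖), ← h1,
    ENNReal.toReal_one]

/-- **Weak E–L at `η = Ψ` plus finiteness forces minimality.**  For a repulsive finite-range
profile `v`, finite and continuous as `x ↦ v(|x|)`, a box `L > 0` and a periodic trial state `Ψ`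
with `periodicEnergy v Ψ ≠ ⊤`: if the weak Euler–Lagrange identity of the registered stub holds at the
single test function `η = Ψ`, then `periodicEnergy v Ψ = periodicGroundStateEnergy v N L`.
[folklore] -/
theorem minimality_of_weakEulerLagrange_self {v : ℝ → ℝ≥0∞} (hv : IsRepulsiveFiniteRange v)
    (htop : ∀ r, v r ≠ ⊤) (hcont : Continuous fun x : Space => (v ‖x‖).toReal) (hL : 0 < L)
    (Ψ : PeriodicTrialState N L) (hfin : periodicEnergy v Ψ ≠ ⊤)
    (hEL : (∫ X in cellN N L,
        ((∑ i : Fin N, ∑ k : Fin 3,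
            (conj (fderiv ℝ Ψ.ψ X (Pi.single i (EuclideanSpace.single k (1 : ℝ)))) *
              fderiv ℝ Ψ.ψ X (Pi.single i (EuclideanSpace.single k (1 : ℝ)))).re) +
          (periodicInteraction v L X).toReal * (conj (Ψ.ψ X) * Ψ.ψ X).re)) =
      (periodicGroundStateEnergy v N L).toReal *
        ∫ X in cellN N L, (conj (Ψ.ψ X) * Ψ.ψ X).re) :
    periodicEnergy v Ψ = periodicGroundStateEnergy v N L := by
  obtain ⟨Cw, hCw, hW⟩ := exists_periodicInteraction_le' hv htop hcont hL N
  have hE0 : periodicGroundStateEnergy v N L ≠ ⊤ :=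
    ne_top_of_le_ne_top hfin (periodicGroundStateEnergy_le v Ψ)
  have hF : periodicEnergy v Ψ = ENNReal.ofReal (∫ X in cellN N L, (kineticDensityReal Ψ.ψ X +
      (periodicInteraction v L X).toReal * ‖Ψ.ψ X‖ ^ 2)) :=
    periodicForm_eq_ofReal' hv.1 hCw hW Ψ.contDiff
  -- the integrand of the weak identity at `η = Ψ` is the energy density, pointwise
  have hptw : ∀ X : Config N,
      (∑ i : Fin N, ∑ k : Fin 3,
          (conj (fderiv ℝ Ψ.ψ X (Pi.single i (EuclideanSpace.single k (1 : ℝ)))) *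
            fderiv ℝ Ψ.ψ X (Pi.single i (EuclideanSpace.single k (1 : ℝ)))).re) +
        (periodicInteraction v L X).toReal * (conj (Ψ.ψ X) * Ψ.ψ X).re =
      kineticDensityReal Ψ.ψ X + (periodicInteraction v L X).toReal * ‖Ψ.ψ X‖ ^ 2 := by
    intro X
    have h1 : (∑ i : Fin N, ∑ k : Fin 3,
          (conj (fderiv ℝ Ψ.ψ X (Pi.single i (EuclideanSpace.single k (1 : ℝ)))) *
            fderiv ℝ Ψ.ψ X (Pi.single i (EuclideanSpace.single k (1 : ℝ)))).re) =
        kineticDensityReal Ψ.ψ X := re_sum_conj_fderiv_mul_self Ψ.ψ X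
    have h2 : (conj (Ψ.ψ X) * Ψ.ψ X).re = ‖Ψ.ψ X‖ ^ 2 := by
      rw [Complex.conj_mul', ← Complex.ofReal_pow, Complex.ofReal_re]
    rw [h1, h2]
  have hI : (∫ X in cellN N L, (kineticDensityReal Ψ.ψ X +
      (periodicInteraction v L X).toReal * ‖Ψ.ψ X‖ ^ 2)) =
        (periodicGroundStateEnergy v N L).toReal := by
    have h := hEL
    rw [integral_re_conj_mul_self_eq_one Ψ, mul_one] at h
    rw [← h]
    exact integral_congr_ae (ae_of_all _ fun X => (hptw X).symm)
  rw [hF, hI, ENNReal.ofReal_toReal hE0]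

/-- **Minimality is implied by the weak Euler–Lagrange hypothesis of `stub_phaseSteinDomination`.**
Under the crux's standing hypotheses on `v` (smooth class), for `L > 0` and a periodic trial state
`Ψ` of `N = n + 1` bosons with `periodicEnergy v Ψ ≠ ⊤`: the stub's hypothesis "weak E–L identity for
every `C¹`, `Lℤ³`-periodic, Bose-symmetric `η`" already gives
`periodicEnergy v Ψ = periodicGroundStateEnergy v (n+1) L` (test it at `η = Ψ.ψ`).  So in the
hypothesis list of `stub_phaseSteinDomination` minimality is REDUNDANT given weak E–L + finiteness, and a
restatement that drops minimality but keeps weak E–L is not weaker. [folklore] -/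
theorem minimality_of_weakEulerLagrange
    (v : ℝ → ℝ≥0∞) (hv : IsRepulsiveFiniteRange v) (htop : ∀ r, v r ≠ ⊤)
    (hC2 : ContDiff ℝ 2 (fun x : Space => (v ‖x‖).toReal))
    (n : ℕ) (L : ℝ) (hL : 0 < L) (Ψ : PeriodicTrialState (n + 1) L)
    (hfin : periodicEnergy v Ψ ≠ ⊤)
    (hEL : ∀ η : Config (n + 1) → ℂ, ContDiff ℝ 1 η →
      (∀ (X : Config (n + 1)) (i : Fin (n + 1)) (k : Fin 3),
        η (X + Pi.single i (EuclideanSpace.single k L)) = η X) →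
      (∀ (σ : Equiv.Perm (Fin (n + 1))) (X : Config (n + 1)), η (X ∘ σ) = η X) →
      (∫ X in cellN (n + 1) L,
          ((∑ i : Fin (n + 1), ∑ k : Fin 3,
              (starRingEnd ℂ (fderiv ℝ η X (Pi.single i (EuclideanSpace.single k (1 : ℝ)))) *
                fderiv ℝ Ψ.ψ X (Pi.single i (EuclideanSpace.single k (1 : ℝ)))).re) +
            (periodicInteraction v L X).toReal * (starRingEnd ℂ (η X) * Ψ.ψ X).re)) =
        (periodicGroundStateEnergy v (n + 1) L).toReal *
          ∫ X in cellN (n + 1) L, (starRingEnd ℂ (η X) * Ψ.ψ X).re) :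
    periodicEnergy v Ψ = periodicGroundStateEnergy v (n + 1) L :=
  minimality_of_weakEulerLagrange_self hv htop hC2.continuous hL Ψ hfin
    (hEL Ψ.ψ Ψ.contDiff Ψ.periodic Ψ.symm)

end Summit.AtomisticToContinuum.BoseEinsteinCondensation.Theorems.InfraredMinimumUncertainty.Negative

end
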